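import Summits.HubbardSuperconductivity.HubbardLadder.NeelRPCorrelationWindowRowsTwelveA
import Summits.HubbardSuperconductivity.HubbardLadder.NeelRPCorrelationWindowRowsTwelveB
import Summits.HubbardSuperconductivity.HubbardLadder.NeelRPCorrelationWindowRowsTwelveC
import Summits.HubbardSuperconductivity.HubbardLadder.NeelRPCorrelationWindowRowsTwelveD
import Summits.HubbardSuperconductivity.HubbardLadder.NeelRPCorrelationWindowRowsTwelveE
import Summits.HubbardSuperconductivity.HubbardLadder.NeelRPCorrelationWindowRowsTwelveF
import Summits.HubbardSuperconductivity.HubbardLadder.NeelRPCorrelationWindowRowsTwelveG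
import Summits.HubbardSuperconductivity.HubbardLadder.Bounds.FdcUpper2x2
import HarnessLib

/-!
# R2 device D46 (part A) — the seven conditional `12×12` correlation-window rows A10.12a–g made UNCONDITIONAL by the certified energy ceiling

HONEST FRAMING: ladder R1–R4 with certified numbers; no claim on H/H₀.  Reference model only (square-lattice
spin-½ Heisenberg antiferromagnet, `J = 1`, ONE finite torus); short-distance signs, not Néel order; nothing on
the Hubbard model.

The seven R2 rows of LEAN FILING REQUEST #105 (`NeelRPCorrelationWindowRowsTwelveA … G`, r2, 2026-08-20) are
kernel theorems CONDITIONAL on the hypothesis `[H_12] : E₀(H_12) ≤ -90.9388` (the 12×12-torus ground energy of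
`heisenbergTorus 2 12 1 1`; `-90.9388 = -0.63152·144`, at the time an uncertified QMC-compatible ceiling).  The kernel
theorem `Bounds.heisTL_fdc_upper_2x2 : HeisTorusFamilyUpper 2 6 (-6585041/10⁷)` (LEAN FILING REQUEST #219.11,
bounds g31, landed 2026-08-22) gives `E₀(H_L) ≤ -0.6585041·L²` for every even `L ≥ 6`, hence at `L = 12`
`E₀(H_12) ≤ -94.8245904 ≤ -90.9388`: the hypothesis `[H_12]` is DISCHARGED (`heisenbergTorus_twelve_groundEnergy_le_fdc`)
and the seven rows become unconditional theorems, each a one-line application BY NAME: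

* `heisRedCorr2_twelve_1_1_ge : 0.0338 ≤ c_12(1,1)`   (A10.12a; energy-free A10F.12a gives 0.0266)
* `heisRedCorr2_twelve_0_2_ge : 0.0093 ≤ c_12(0,2)`   (A10.12b; A10F.12b gives 0.0101 — stronger, kept for completeness)
* `heisRedCorr2_twelve_1_2_le : c_12(1,2) ≤ -0.0072`  (A10.12c; A10F.12c gives -0.0081 — stronger, kept for completeness)
* `heisRedCorr2_twelve_2_2_ge : 0.0061 ≤ c_12(2,2)`   (A10.12d; A10F.12d gives 0.0046)
* `heisRedCorr2_twelve_0_3_le : c_12(0,3) ≤ -0.0076`  (A10.12e; A10F.12f gives -0.0058)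
* `heisRedCorr2_twelve_1_3_ge : 0.0024 ≤ c_12(1,3)`   (A10.12f; A10F.12e gives 0.0025 — stronger, kept for completeness)
* `heisRedCorr2_twelve_2_3_le : c_12(2,3) ≤ -0.0020`  (A10.12g; NO energy-free row exists at (2,3): this is the first
  UNCONDITIONAL strict Néel sign at distance √13 on the 12×12 torus — Marshall–Lieb–Mattis gives only `≤ 0`).

No new certificate, no decision-procedure kernel, no hypothesis; standard axioms.  Companion parts B–D of D46
(`NeelRPCeilingCorrelationRowsTwelveB/C/D`) add the cells (0,5), (2,4), (1,4) by new LP certificates under the same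
ceiling.  Tasaki (2020) §2.5, §4.1; Kennedy–Lieb–Shastry (1988). [folklore]
-/

noncomputable section

open Literature.MathematicalPhysics.QuantumLattice Literature.Probability.LatticeModels

namespace Summit.HubbardSuperconductivity.HubbardLadder

/-- The hypothesis `[H_12]` of the #105 rows, discharged: `E₀(H_12) ≤ -0.6585041·12² = -94.8245904 ≤ -90.9388`
from `Bounds.heisTL_fdc_upper_2x2` (#219.11) at `L = 12` (`2 ∣ 12`, `6 ≤ 12`). [folklore] -/
theorem heisenbergTorus_twelve_groundEnergy_le_fdc :
    (heisenbergTorus 2 12 1 1).groundEnergy ≤ -90.9388 := by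
  haveI : NeZero (12 : ℕ) := ⟨by norm_num⟩
  have hE : (heisenbergTorus 2 12 1 1).groundEnergy ≤
      (((-6585041 : ℚ) / 10000000 : ℚ) : ℝ) * ((12 : ℕ) : ℝ) ^ 2 :=
    Bounds.heisTL_fdc_upper_2x2 12 (Dvd.intro 6 rfl) (by norm_num)
  have hq : (((-6585041 : ℚ) / 10000000 : ℚ) : ℝ) * ((12 : ℕ) : ℝ) ^ 2 ≤ -90.9388 := by
    push_cast; norm_num
  exact hE.trans hq

/-- A10.12a unconditional: `0.0338 ≤ c_12(1,1)`. -/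
theorem heisRedCorr2_twelve_1_1_ge : (0.0338 : ℝ) ≤ heisRedCorr2 12 1 1 1 :=
  heisRedCorr2_twelve_1_1_ge_of_groundEnergy_le heisenbergTorus_twelve_groundEnergy_le_fdc

/-- A10.12b unconditional: `0.0093 ≤ c_12(0,2)`. -/
theorem heisRedCorr2_twelve_0_2_ge : (0.0093 : ℝ) ≤ heisRedCorr2 12 1 0 2 :=
  heisRedCorr2_twelve_0_2_ge_of_groundEnergy_le heisenbergTorus_twelve_groundEnergy_le_fdc

/-- A10.12c unconditional: `c_12(1,2) ≤ -0.0072`. -/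
theorem heisRedCorr2_twelve_1_2_le : heisRedCorr2 12 1 1 2 ≤ -0.0072 :=
  heisRedCorr2_twelve_1_2_le_of_groundEnergy_le heisenbergTorus_twelve_groundEnergy_le_fdc

/-- A10.12d unconditional: `0.0061 ≤ c_12(2,2)`. -/
theorem heisRedCorr2_twelve_2_2_ge : (0.0061 : ℝ) ≤ heisRedCorr2 12 1 2 2 :=
  heisRedCorr2_twelve_2_2_ge_of_groundEnergy_le heisenbergTorus_twelve_groundEnergy_le_fdc

/-- A10.12e unconditional: `c_12(0,3) ≤ -0.0076`. -/
theorem heisRedCorr2_twelve_0_3_le : heisRedCorr2 12 1 0 3 ≤ -0.0076 :=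
  heisRedCorr2_twelve_0_3_le_of_groundEnergy_le heisenbergTorus_twelve_groundEnergy_le_fdc

/-- A10.12f unconditional: `0.0024 ≤ c_12(1,3)`. -/
theorem heisRedCorr2_twelve_1_3_ge : (0.0024 : ℝ) ≤ heisRedCorr2 12 1 1 3 :=
  heisRedCorr2_twelve_1_3_ge_of_groundEnergy_le heisenbergTorus_twelve_groundEnergy_le_fdc

/-- A10.12g unconditional: `c_12(2,3) ≤ -0.0020` — the first unconditional strict Néel sign at distance √13 on the
12×12 torus (no energy-free row exists at (2,3); Marshall–Lieb–Mattis gives only `≤ 0`). -/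
theorem heisRedCorr2_twelve_2_3_le : heisRedCorr2 12 1 2 3 ≤ -0.0020 :=
  heisRedCorr2_twelve_2_3_le_of_groundEnergy_le heisenbergTorus_twelve_groundEnergy_le_fdc

end Summit.HubbardSuperconductivity.HubbardLadder
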